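import Summits.CriticalPhenomena.PercolationContinuityZ3.Theorems.PercNearOneGluingNoHeavyLowerTailSahiCTCLadderCountsGeneral
import HarnessLib

/-!
# `NoHeavyLowerTail` (crux stmt-CriticalPhenomena-4575), P3 lane: supply of a cube in terms of the charged kinds (general row)

Support file (seat `prim-l12-p3`, gen 26; `--supports stmt-CriticalPhenomena-4575`).  README blueprint step 2, general form, first part:
inside the cube `(A, Y)` the charged pairs of all kinds `j` give pairwise different common `ℓ`-sets (`ℓ = t − #(D ∖ A)`), so
`Σ_j #kindsIn_j(A,Y) ≤ #csetsT(D ∖ A, A ∪ (T ∖ Y), ℓ)` (`sum_card_kindsIn_le_csetsT`); with `densityT_le_kap` this is the plain supply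
of one cube.  Nothing is asserted about the crux.
-/

namespace Summit.CriticalPhenomena.PercolationContinuityZ3.Theorems.SahiCTCForms

open Finset MvPolynomial SahiCTCGenFun SahiCTCWeightedLYM

variable {α : Type*} [DecidableEq α] [Fintype α]

section SupplyGeneral
variable {𝒳 𝒵 : Finset (Finset α)}

omit [Fintype α] in
/-- **Kinds inside a cube are distinct common sets**: `Σ_{j ≤ #D} #kindsIn_j(A,Y) ≤ #csetsT(D ∖ A, A ∪ (T ∖ Y), t − #(D ∖ A))`
(`A ⊆ D`, `#D ≤ t`). [this work] -/
theorem sum_card_kindsIn_le_csetsT {m : α →₀ ℕ} {t : ℕ} {A Y : Finset α} (hA : A ⊆ dbl m) (hδt : #(dbl m) ≤ t) :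
    ∑ j ∈ range (#(dbl m) + 1), #(kindsIn 𝒳 𝒵 m t j A Y)
      ≤ #(csetsT 𝒳 𝒵 (dbl m \ A) (A ∪ (lev m 1 \ Y)) (t - #(dbl m \ A))) := by
  set S := csetsT 𝒳 𝒵 (dbl m \ A) (A ∪ (lev m 1 \ Y)) (t - #(dbl m \ A))
  have hDT := disjoint_dbl_lev_one m
  have hAD : #A ≤ #(dbl m) := card_le_card hA
  -- fibres of `U ↦ #(U ∩ A) + #D − #A`
  have hfib : ∑ j ∈ range (#(dbl m) + 1), #(S.filter fun U => #(U ∩ A) + #(dbl m) - #A = j) = #S := by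
    rw [← card_eq_sum_card_fiberwise]
    intro U _
    show #(U ∩ A) + #(dbl m) - #A ∈ range (#(dbl m) + 1)
    have : #(U ∩ A) ≤ #A := card_le_card inter_subset_right
    exact mem_range.2 (by omega)
  rw [← hfib]
  refine sum_le_sum fun j hj => ?_
  by_cases hjA : #(dbl m \ A) ≤ j
  · have hjt : j ≤ t := by have := mem_range.1 hj; omega
    calc #(kindsIn 𝒳 𝒵 m t j A Y)
        = #((kindsIn 𝒳 𝒵 m t j A Y).filter fun q => #((q.1 ∩ A ∪ q.2) ∩ A) + #(dbl m) - #A = j) := by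
          rw [filter_true_of_mem]
          intro q hq
          obtain ⟨-, ⟨hY', -⟩, -, -, -⟩ := mem_kindsIn.1 hq
          have h1 := (card_inter_fst_of_mem_kindsIn hA hq).1
          have h2 : (q.1 ∩ A ∪ q.2) ∩ A = A ∩ q.1 := by
            rw [union_inter_distrib_right, disjoint_iff_inter_eq_empty.1 (Disjoint.mono hY' hA hDT.symm), union_empty,
              inter_assoc, inter_self, inter_comm]
          rw [h2]; omega
      _ ≤ #(S.filter fun U => #(U ∩ A) + #(dbl m) - #A = j) :=
          card_kindsIn_filter_le_csetsT hA hjt hjA (fun U => #(U ∩ A) + #(dbl m) - #A = j)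
  · have : kindsIn 𝒳 𝒵 m t j A Y = ∅ := by
      refine filter_false_of_mem fun q hq => ?_
      obtain ⟨hA', _⟩ := mem_product.1 hq
      obtain ⟨_, hjc⟩ := mem_powersetCard.1 hA'
      intro h
      exact hjA (hjc ▸ card_le_card h.2.1)
    rw [this, card_empty]; exact Nat.zero_le _

end SupplyGeneral

end Summit.CriticalPhenomena.PercolationContinuityZ3.Theorems.SahiCTCForms
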